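import Literature.Probability.Process.ConformalTimeChangeDefs
import Literature.Probability.Process.LevyCharacterisationCore
import HarnessLib

/-!
# The conformal exponential martingale of planar Brownian motion

P. Lévy's conformal invariance of planar Brownian motion (Lawler, *Conformally Invariant
Processes in the Plane* (2005), Thm. 2.2; Le Gall (2016), Thm. 7.19) says that for `f`
holomorphic and `Z` a planar Brownian motion, `f(Z)` is a time change of a planar Brownian
motion by the **conformal clock** `σ_t = ∫₀ᵗ |f'(Z_s)|² ds`. This file proves the analytic heart
of the statement in the tree's raw-filtration martingale language, for the planar Brownian
motion `X = x₀ + W` of `IsBrownianVec` (`BrownianVec`) stopped on leaving a relatively compact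
open set `U` (`closure U ⊆ D`):

* `stopT`, `confPos`, `confClock` — the stopped time `t ∧ ρ_U`, the stopped position
  `X_{t ∧ ρ_U}` and the stopped conformal clock `σ_{t ∧ ρ_U} = ∫₀^{t∧ρ_U} |f'(X_r)|² dr`
  (written with the stopped position in the integrand, which changes nothing before `ρ_U` and
  makes the integrand continuous and bounded in real time);
* `stoppedProcess_dynkin_eq_of_lap_eq` — Dynkin's stopped process of a `C²_c` function whose
  Laplacian is a given continuous function near `closure U`, read along the confined paths;
* `hasMartingaleClock_rePart` — **for every `θ ∈ ℂ`, `Y = Re(θ̄ (f(X_{·∧ρ}) − f(x₀)))` is a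
  bounded martingale with clock `|θ|² σ`** (both `Y` and `Y² − |θ|²σ` are martingales: Dynkin's
  formula for `χ·Re(θ̄ f)` and `χ·Re(θ̄ f)²`, `ConformalLaplacian`), normalised to the
  hypothesis structure `HasMartingaleClock` of `LevyCharacterisationCore`;
* `integral_mul_cexp_conformal_eq` — hence **the exponential martingale identity**
  `E[G exp(i Re(θ̄ f(X_{t∧ρ})) + |θ|² σ_{t∧ρ}/2)] = E[G exp(i Re(θ̄ f(X_{s∧ρ})) + |θ|² σ_{s∧ρ}/2)]`
  for `s ≤ t` and bounded `𝓕_s`-measurable `G` (`HasMartingaleClock.integral_mul_cexp_eq`, the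
  discrete-Itô exponential martingale of the tree's proof of Lévy's characterisation).

The isotropy `½Δ Re(θ̄f)² = |θ|²|f'|²` (the clock does not depend on the direction of `θ`) is
what makes the time-changed process a *planar* Brownian motion (sequel files).

## References

* G. F. Lawler, *Conformally Invariant Processes in the Plane*, AMS (2005), Thm. 2.2.
* J.-F. Le Gall, *Brownian Motion, Martingales, and Stochastic Calculus* (2016), Thm. 5.12
  (exponential martingale), Thm. 7.19 (conformal invariance).
* P. Lévy, *Processus stochastiques et mouvement brownien* (1948), Ch. VI.
-/

noncomputable section

open MeasureTheory Filter Topology Set Complex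
open scoped NNReal ENNReal BigOperators ComplexConjugate

namespace Literature.Probability.Process

variable {Ω : Type*} {mΩ : MeasurableSpace Ω} {P : Measure Ω} {W : ℝ≥0 → Ω → (Fin 2 → ℝ)}

namespace IsBrownianVec

/-! ### The stopped time, position and conformal clock -/

variable {x₀ : Fin 2 → ℝ} {U : Set (Fin 2 → ℝ)} {D : Set ℂ} {f : ℂ → ℂ}

/-- The stopped time is monotone. [folklore] -/
theorem stopT_mono (ω : Ω) {s t : ℝ≥0} (h : s ≤ t) : stopT x₀ W U s ω ≤ stopT x₀ W U t ω := by
  unfold stopT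
  induction hitTime x₀ W Uᶜ ω with
  | top => rw [untopA_min_coe_top, untopA_min_coe_top]; exact h
  | coe T => rw [untopA_min_coe_coe, untopA_min_coe_coe]; exact min_le_min_right T h

/-- The stopped time is `1`-Lipschitz: `(t ∧ ρ) − (s ∧ ρ) ≤ t − s` for `s ≤ t`. [folklore] -/
theorem stopT_sub_le (ω : Ω) {s t : ℝ≥0} (h : s ≤ t) :
    (stopT x₀ W U t ω : ℝ) - stopT x₀ W U s ω ≤ (t : ℝ) - s := by
  have h1 := dist_untopA_min_coe_le (hitTime x₀ W Uᶜ ω) s t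
  have hm : (stopT x₀ W U s ω : ℝ) ≤ stopT x₀ W U t ω := NNReal.coe_le_coe.2 (stopT_mono ω h)
  have hst : (s : ℝ) ≤ t := NNReal.coe_le_coe.2 h
  rw [NNReal.dist_eq, NNReal.dist_eq, abs_of_nonneg (sub_nonneg.2 hst)] at h1
  unfold stopT at hm ⊢
  rw [abs_of_nonneg (sub_nonneg.2 hm)] at h1
  exact h1

/-- The stopped time is continuous in time. [folklore] -/
theorem continuous_stopT (ω : Ω) : Continuous fun t ↦ stopT x₀ W U t ω :=
  continuous_untopA_min_coe _

/-- **Confinement**: up to the exit time the path is in `closure U` (`x₀ ∈ U` open). [folklore] -/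
theorem mem_closure_of_le (hW : IsBrownianVec W P) (hU : IsOpen U) (hx₀ : x₀ ∈ U) (t : ℝ≥0) (ω : Ω)
    {r : ℝ≥0} (hr : r ≤ stopT x₀ W U t ω) : x₀ + W r ω ∈ closure U := by
  have h := hW.mem_closure_compl_of_le hU.isClosed_compl (fun h ↦ h hx₀) t ω hr
  rwa [compl_compl] at h

/-- The stopped position lies in `closure U`. [folklore] -/
theorem confPos_mem_closure (hW : IsBrownianVec W P) (hU : IsOpen U) (hx₀ : x₀ ∈ U) (t : ℝ≥0) (ω : Ω) :
    confPos x₀ W U t ω ∈ closure U :=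
  hW.mem_closure_of_le hU hx₀ t ω le_rfl

/-- The stopped position has continuous paths. [folklore] -/
theorem continuous_confPos (hW : IsBrownianVec W P) (ω : Ω) : Continuous fun t ↦ confPos x₀ W U t ω :=
  (continuous_const.add (hW.continuous_path ω)).comp (continuous_stopT ω)

/-- Before the stopped time the stopped position is the position: `X_{r∧ρ} = X_r` for
`r ≤ t ∧ ρ`. [folklore] -/
theorem confPos_of_le {t r : ℝ≥0} {ω : Ω} (h : r ≤ stopT x₀ W U t ω) : confPos x₀ W U r ω = x₀ + W r ω := by
  unfold confPos stopT at *
  congr 1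
  induction hρ : hitTime x₀ W Uᶜ ω with
  | top => rw [untopA_min_coe_top]
  | coe T =>
    rw [hρ, untopA_min_coe_coe] at h
    rw [untopA_min_coe_coe, min_eq_left (le_trans h (min_le_right _ _))]

/-- A function continuous on `toC⁻¹ D ⊇ closure U` read along the stopped path is continuous in
real time. [folklore] -/
theorem continuous_comp_confPos (hW : IsBrownianVec W P) (hU : IsOpen U) (hUD : closure U ⊆ toC ⁻¹' D)
    (hx₀ : x₀ ∈ U) {g : (Fin 2 → ℝ) → ℝ} (hg : ContinuousOn g (toC ⁻¹' D)) (ω : Ω) :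
    Continuous fun r : ℝ ↦ g (confPos x₀ W U r.toNNReal ω) :=
  (hg.comp_continuous ((hW.continuous_confPos ω).comp continuous_real_toNNReal)
    fun _ ↦ hUD (hW.confPos_mem_closure hU hx₀ _ ω))

/-- The stopped position is adapted (indeed `𝓕_t`-measurable). [folklore] -/
theorem stronglyMeasurable_confPos (hW : IsBrownianVec W P) (hU : IsOpen U) (t : ℝ≥0) :
    StronglyMeasurable[hW.natFiltration t] (confPos x₀ W U t) := by
  have hX : StronglyAdapted hW.natFiltration fun t ω ↦ x₀ + W t ω := fun t ↦
    stronglyMeasurable_const.add (hW.stronglyAdapted t)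
  have hprog : IsStronglyProgressive hW.natFiltration fun t ω ↦ x₀ + W t ω :=
    hX.isStronglyProgressive_of_continuous fun ω ↦ continuous_const.add (hW.continuous_path ω)
  have h := (hprog.stoppedProcess (hW.isStoppingTime_hitTime (x₀ := x₀) hU.isClosed_compl)).stronglyAdapted t
  exact h

/-! ### Dynkin's stopped process along confined paths -/

/-- **Dynkin's stopped process read along confined paths.** If `g ∈ C²` and `lap g = L` on an
open `O ⊇ closure U`, then for `X = x₀ + W` stopped at the exit time `ρ` of `U ∋ x₀`,
`M^g_{t∧ρ} = g(X_{t∧ρ}) − g(x₀) − ½∫₀^{t∧ρ} L(X_r) dr`. [folklore] -/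
theorem stoppedProcess_dynkin_eq_of_lap_eq (hW : IsBrownianVec W P) (hU : IsOpen U) (hx₀ : x₀ ∈ U)
    {g : (Fin 2 → ℝ) → ℝ} {O : Set (Fin 2 → ℝ)} (hUO : closure U ⊆ O)
    {L : (Fin 2 → ℝ) → ℝ} (hlap : ∀ y ∈ O, lap g y = L y) (t : ℝ≥0) (ω : Ω) :
    stoppedProcess (dynkin g x₀ W) (hitTime x₀ W Uᶜ) t ω =
      g (confPos x₀ W U t ω) - g x₀ -
        1 / 2 * ∫ r in (0 : ℝ)..(stopT x₀ W U t ω : ℝ), L (x₀ + W r.toNNReal ω) := by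
  simp only [stoppedProcess, dynkin]
  have hI : ∫ r in (0 : ℝ)..(stopT x₀ W U t ω : ℝ), lap g (x₀ + W r.toNNReal ω) =
      ∫ r in (0 : ℝ)..(stopT x₀ W U t ω : ℝ), L (x₀ + W r.toNNReal ω) := by
    refine intervalIntegral.integral_congr fun r hr ↦ ?_
    rw [uIcc_of_le (stopT x₀ W U t ω).coe_nonneg] at hr
    exact hlap _ (hUO (hW.mem_closure_of_le hU hx₀ t ω (Real.toNNReal_le_iff_le_coe.2 hr.2)))
  rw [← hI]
  rfl

/-- A smooth cutoff equal to `1` near `closure U` inside `toC⁻¹ D`, multiplied by a function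
`C²` on `toC⁻¹ D`: a global `C²_c` function. [folklore] -/
theorem exists_cutoff_mul (hD : IsOpen D) (hUc : IsCompact (closure U)) (hUD : closure U ⊆ toC ⁻¹' D)
    {V : (Fin 2 → ℝ) → ℝ} (hV : ContDiffOn ℝ 2 V (toC ⁻¹' D)) :
    ∃ g : (Fin 2 → ℝ) → ℝ, ContDiff ℝ 2 g ∧ HasCompactSupport g ∧
      ∃ O : Set (Fin 2 → ℝ), IsOpen O ∧ closure U ⊆ O ∧ O ⊆ toC ⁻¹' D ∧
        (∀ y ∈ O, g =ᶠ[𝓝 y] V) ∧ ∀ y ∈ O, g y = V y := by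
  have hDo : IsOpen (toC ⁻¹' D) := isOpen_preimage_toC hD
  obtain ⟨χ, hχ, hχc, hχU, O, hO, hKO, hOU, hχ1⟩ := exists_contDiff_cutoff hUc hDo hUD
  refine ⟨fun y ↦ χ y * V y, ?_, hχc.mul_right, O, hO, hKO, hOU, fun y hy ↦ ?_, fun y hy ↦ ?_⟩
  · rw [contDiff_iff_contDiffAt]
    intro y
    by_cases hy : y ∈ toC ⁻¹' D
    · exact hχ.contDiffAt.mul (hV.contDiffAt (hDo.mem_nhds hy))
    · have hy' : y ∉ tsupport χ := fun h ↦ hy (hχU h)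
      have h0 : (fun y ↦ χ y * V y) =ᶠ[𝓝 y] fun _ ↦ 0 := by
        filter_upwards [(isClosed_tsupport χ).isOpen_compl.mem_nhds hy'] with z hz
        simp [image_eq_zero_of_notMem_tsupport hz]
      exact (contDiffAt_const (c := (0 : ℝ))).congr_of_eventuallyEq h0
  · filter_upwards [hO.mem_nhds hy] with z hz
    simp [hχ1 z hz]
  · simp [hχ1 y hy]

/-! ### The martingale clock of `Re(θ̄ f(X))` -/

section Clock

variable [IsProbabilityMeasure P]

/-- **`Re(θ̄ f(X^ρ)) − Re(θ̄ f(x₀))` is Dynkin's stopped martingale of (a cutoff of) the harmonic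
function `V_θ = Re(θ̄ f)`**, hence an a.e. martingale. [cite: Lawler2005ConformallyInvariant, §2.1 (proof of Thm. 2.2)] -/
theorem isAEMartingale_rePart_confPos (hW : IsBrownianVec W P) (hD : IsOpen D) (hf : DifferentiableOn ℂ f D)
    (hU : IsOpen U) (hUc : IsCompact (closure U)) (hUD : closure U ⊆ toC ⁻¹' D) (hx₀ : x₀ ∈ U) (θ : ℂ) :
    IsAEMartingale (fun t ω ↦ rePart θ f (confPos x₀ W U t ω) - rePart θ f x₀) hW.natFiltration P := by
  obtain ⟨g, hg, hgc, O, hO, hUO, hOD, hgV, hgV'⟩ :=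
    exists_cutoff_mul hD hUc hUD (contDiffOn_rePart hD hf θ)
  have hlap : ∀ y ∈ O, lap g y = (fun _ ↦ (0 : ℝ)) y := fun y hy ↦ by
    rw [lap_congr_of_eventuallyEq (hgV y hy)]
    exact lap_rePart_eq_zero hD hf θ (hOD hy)
  have hM := (hW.martingale_dynkin hg hgc x₀).isAEMartingale_stoppedProcess
    (ae_of_all _ fun ω ↦ hW.continuous_dynkin hg ω) (hW.isStoppingTime_hitTime (x₀ := x₀) hU.isClosed_compl).isOptionalTime
  refine hM.congr fun t ↦ ae_of_all _ fun ω ↦ ?_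
  rw [hW.stoppedProcess_dynkin_eq_of_lap_eq hU hx₀ hUO hlap t ω, hgV' _ (hW.confPos_mem_closure hU hx₀ t ω |> hUO),
    hgV' _ (hUO (subset_closure hx₀))]
  simp

/-- **`Re(θ̄ f(X^ρ))² − Re(θ̄ f(x₀))² − |θ|² σ` is Dynkin's stopped martingale of (a cutoff of)
`V_θ²`** (`½ΔV_θ² = |θ|²|f'|²`), hence an a.e. martingale. [cite: Lawler2005ConformallyInvariant, §2.1 (proof of Thm. 2.2)] -/
theorem isAEMartingale_rePart_sq_confPos (hW : IsBrownianVec W P) (hD : IsOpen D) (hf : DifferentiableOn ℂ f D)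
    (hU : IsOpen U) (hUc : IsCompact (closure U)) (hUD : closure U ⊆ toC ⁻¹' D) (hx₀ : x₀ ∈ U) (θ : ℂ) :
    IsAEMartingale (fun t ω ↦ rePart θ f (confPos x₀ W U t ω) ^ 2 - rePart θ f x₀ ^ 2 -
      ‖θ‖ ^ 2 * confClock x₀ W f U t ω) hW.natFiltration P := by
  obtain ⟨g, hg, hgc, O, hO, hUO, hOD, hgV, hgV'⟩ :=
    exists_cutoff_mul hD hUc hUD (contDiffOn_rePart_sq hD hf θ)
  have hlap : ∀ y ∈ O, lap g y = (fun y ↦ 2 * (‖θ‖ ^ 2 * ‖deriv f (toC y)‖ ^ 2)) y := fun y hy ↦ by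
    rw [lap_congr_of_eventuallyEq (hgV y hy)]
    exact lap_rePart_sq hD hf θ (hOD hy)
  have hM := (hW.martingale_dynkin hg hgc x₀).isAEMartingale_stoppedProcess
    (ae_of_all _ fun ω ↦ hW.continuous_dynkin hg ω) (hW.isStoppingTime_hitTime (x₀ := x₀) hU.isClosed_compl).isOptionalTime
  refine hM.congr fun t ↦ ae_of_all _ fun ω ↦ ?_
  rw [hW.stoppedProcess_dynkin_eq_of_lap_eq hU hx₀ hUO hlap t ω, hgV' _ (hW.confPos_mem_closure hU hx₀ t ω |> hUO),
    hgV' _ (hUO (subset_closure hx₀))]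
  beta_reduce
  have hI : ∫ r in (0 : ℝ)..(stopT x₀ W U t ω : ℝ), 2 * (‖θ‖ ^ 2 * ‖deriv f (toC (x₀ + W r.toNNReal ω))‖ ^ 2) =
      ∫ r in (0 : ℝ)..(stopT x₀ W U t ω : ℝ),
        2 * (‖θ‖ ^ 2 * ‖deriv f (toC (confPos x₀ W U r.toNNReal ω))‖ ^ 2) := by
    refine intervalIntegral.integral_congr fun r hr ↦ ?_
    rw [uIcc_of_le (stopT x₀ W U t ω).coe_nonneg] at hr
    rw [confPos_of_le (Real.toNNReal_le_iff_le_coe.2 hr.2)]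
  rw [hI, confClock, intervalIntegral.integral_const_mul, intervalIntegral.integral_const_mul]
  simp only [clockIntegrand_apply]
  ring

omit [IsProbabilityMeasure P] in
/-- `|f'|²` (read through `toC`) is continuous on `toC⁻¹ D`. [folklore] -/
theorem _root_.Literature.Probability.Process.continuousOn_deriv_sq (hD : IsOpen D) (hf : DifferentiableOn ℂ f D) :
    ContinuousOn (fun y : Fin 2 → ℝ ↦ ‖deriv f (toC y)‖ ^ 2) (toC ⁻¹' D) :=
  (((differentiableOn_deriv hD hf).continuousOn.comp continuous_toC.continuousOn
    fun _ hy ↦ hy).norm).pow 2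

omit [IsProbabilityMeasure P] in
/-- The clock is a left-nested difference of interval integrals of a function continuous along
the confined path: `σ_t − σ_s = ∫_{s∧ρ}^{t∧ρ}`. [folklore] -/
theorem confClock_sub (hW : IsBrownianVec W P) (hD : IsOpen D) (hf : DifferentiableOn ℂ f D)
    (hU : IsOpen U) (hUD : closure U ⊆ toC ⁻¹' D) (hx₀ : x₀ ∈ U) (ω : Ω) (s t : ℝ≥0) :
    confClock x₀ W f U t ω - confClock x₀ W f U s ω =
      ∫ r in (stopT x₀ W U s ω : ℝ)..(stopT x₀ W U t ω : ℝ),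
        ‖deriv f (toC (confPos x₀ W U r.toNNReal ω))‖ ^ 2 := by
  have hc := hW.continuous_comp_confPos hU hUD hx₀ (continuousOn_deriv_sq hD hf) ω
  rw [confClock, confClock]
  exact intervalIntegral.integral_interval_sub_left (hc.intervalIntegrable _ _) (hc.intervalIntegrable _ _)

/-- A bound for `|f'|²` on `closure U`, at least `1`. [folklore] -/
theorem exists_bound_deriv_sq (hD : IsOpen D) (hf : DifferentiableOn ℂ f D) (hUc : IsCompact (closure U))
    (hUD : closure U ⊆ toC ⁻¹' D) :
    ∃ M : ℝ, 1 ≤ M ∧ ∀ y ∈ closure U, ‖deriv f (toC y)‖ ^ 2 ≤ M := by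
  have hq : ContinuousOn (fun y : Fin 2 → ℝ ↦ ‖deriv f (toC y)‖ ^ 2) (closure U) :=
    ((((differentiableOn_deriv hD hf).continuousOn.comp continuous_toC.continuousOn
      fun y hy ↦ hy).norm).pow 2).mono hUD
  obtain ⟨B, hB⟩ := hUc.exists_bound_of_continuousOn hq
  refine ⟨max 1 B, le_max_left _ _, fun y hy ↦ ?_⟩
  have := hB y hy
  rw [Real.norm_eq_abs, abs_of_nonneg (by positivity)] at this
  exact this.trans (le_max_right _ _)

/-- A bound for `|Re(θ̄ f)|` on `closure U`. [folklore] -/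
theorem exists_bound_rePart (hD : IsOpen D) (hf : DifferentiableOn ℂ f D) (hUc : IsCompact (closure U))
    (hUD : closure U ⊆ toC ⁻¹' D) (θ : ℂ) :
    ∃ B : ℝ, 0 ≤ B ∧ ∀ y ∈ closure U, |rePart θ f y| ≤ B := by
  have hc : ContinuousOn (rePart θ f) (closure U) :=
    ((contDiffOn_rePart hD hf θ (n := 2)).continuousOn).mono hUD
  obtain ⟨B, hB⟩ := hUc.exists_bound_of_continuousOn hc
  exact ⟨max 0 B, le_max_left _ _, fun y hy ↦ (hB y hy).trans (le_max_right _ _)⟩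

/-- **The martingale clock of `Re(θ̄ f(X^ρ))`** (normalised): with `M ≥ |f'|²` on `closure U`
and `a = ‖θ‖ √M`, the process `Y = (Re θ̄ f(X^ρ) − Re θ̄ f(x₀))/a` and the clock `|θ|²σ/a²`
satisfy `HasMartingaleClock` (`Y`, `Y² − clock` martingales; clock nondecreasing, `1`-Lipschitz;
`Y` bounded). [cite: Lawler2005ConformallyInvariant, Thm. 2.2] -/
theorem hasMartingaleClock_rePart (hW : IsBrownianVec W P) (hD : IsOpen D) (hf : DifferentiableOn ℂ f D)
    (hU : IsOpen U) (hUc : IsCompact (closure U)) (hUD : closure U ⊆ toC ⁻¹' D) (hx₀ : x₀ ∈ U)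
    {θ : ℂ} (hθ : θ ≠ 0) {M : ℝ} (hM1 : 1 ≤ M) (hM : ∀ y ∈ closure U, ‖deriv f (toC y)‖ ^ 2 ≤ M)
    {B : ℝ} (hB : ∀ y ∈ closure U, |rePart θ f y| ≤ B) :
    HasMartingaleClock
      (fun t ω ↦ (rePart θ f (confPos x₀ W U t ω) - rePart θ f x₀) / (‖θ‖ * Real.sqrt M))
      (fun t ω ↦ ‖θ‖ ^ 2 * confClock x₀ W f U t ω / (‖θ‖ * Real.sqrt M) ^ 2)
      hW.natFiltration P (2 * B / (‖θ‖ * Real.sqrt M)) := by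
  have hθ' : 0 < ‖θ‖ := norm_pos_iff.2 hθ
  have hM0 : 0 < M := by linarith
  have hsq : Real.sqrt M ^ 2 = M := Real.sq_sqrt hM0.le
  have ha : 0 < ‖θ‖ * Real.sqrt M := mul_pos hθ' (Real.sqrt_pos.2 hM0)
  have ha2 : (‖θ‖ * Real.sqrt M) ^ 2 = ‖θ‖ ^ 2 * M := by rw [mul_pow, hsq]
  -- nonnegativity and monotonicity of the clock integrand along the path
  have hmono : ∀ ω ⦃s t : ℝ≥0⦄, s ≤ t → confClock x₀ W f U s ω ≤ confClock x₀ W f U t ω ∧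
      confClock x₀ W f U t ω - confClock x₀ W f U s ω ≤ M * ((t : ℝ) - s) := by
    intro ω s t hst
    have hsub := hW.confClock_sub hD hf hU hUD hx₀ ω s t
    have hle : (stopT x₀ W U s ω : ℝ) ≤ stopT x₀ W U t ω := NNReal.coe_le_coe.2 (stopT_mono ω hst)
    have hnn : 0 ≤ ∫ r in (stopT x₀ W U s ω : ℝ)..(stopT x₀ W U t ω : ℝ),
        ‖deriv f (toC (confPos x₀ W U r.toNNReal ω))‖ ^ 2 :=
      intervalIntegral.integral_nonneg hle fun r _ ↦ by positivity
    have hbd : ‖∫ r in (stopT x₀ W U s ω : ℝ)..(stopT x₀ W U t ω : ℝ),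
        ‖deriv f (toC (confPos x₀ W U r.toNNReal ω))‖ ^ 2‖ ≤
          M * |(stopT x₀ W U t ω : ℝ) - stopT x₀ W U s ω| := by
      refine intervalIntegral.norm_integral_le_of_norm_le_const fun r _ ↦ ?_
      rw [Real.norm_eq_abs, abs_of_nonneg (by positivity)]
      exact hM _ (hW.confPos_mem_closure hU hx₀ _ ω)
    rw [Real.norm_eq_abs, abs_of_nonneg hnn, abs_of_nonneg (by linarith)] at hbd
    refine ⟨by linarith, ?_⟩
    rw [hsub]
    exact hbd.trans (mul_le_mul_of_nonneg_left (stopT_sub_le ω hst) hM0.le)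
  refine ⟨?_, ?_, fun ω ↦ ?_, fun ω s t hst ↦ ?_, fun ω s t hst ↦ ?_, ae_of_all _ fun ω t ↦ ?_⟩
  · -- `Y` is a martingale
    have h := (hW.isAEMartingale_rePart_confPos hD hf hU hUc hUD hx₀ θ).const_mul (1 / (‖θ‖ * Real.sqrt M))
    refine h.congr fun t ↦ ae_of_all _ fun ω ↦ ?_
    show 1 / (‖θ‖ * Real.sqrt M) * (rePart θ f (confPos x₀ W U t ω) - rePart θ f x₀) =
      (rePart θ f (confPos x₀ W U t ω) - rePart θ f x₀) / (‖θ‖ * Real.sqrt M)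
    ring
  · -- `Y² − clock` is a martingale
    have h1 := hW.isAEMartingale_rePart_sq_confPos hD hf hU hUc hUD hx₀ θ
    have h2 := hW.isAEMartingale_rePart_confPos hD hf hU hUc hUD hx₀ θ
    have h := (h1.sub (h2.const_mul (2 * rePart θ f x₀))).const_mul (1 / (‖θ‖ * Real.sqrt M) ^ 2)
    refine h.congr fun t ↦ ae_of_all _ fun ω ↦ ?_
    show 1 / (‖θ‖ * Real.sqrt M) ^ 2 * ((rePart θ f (confPos x₀ W U t ω) ^ 2 - rePart θ f x₀ ^ 2 -
        ‖θ‖ ^ 2 * confClock x₀ W f U t ω) - 2 * rePart θ f x₀ *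
          (rePart θ f (confPos x₀ W U t ω) - rePart θ f x₀)) =
      ((rePart θ f (confPos x₀ W U t ω) - rePart θ f x₀) / (‖θ‖ * Real.sqrt M)) ^ 2 -
        ‖θ‖ ^ 2 * confClock x₀ W f U t ω / (‖θ‖ * Real.sqrt M) ^ 2
    have hane : ‖θ‖ * Real.sqrt M ≠ 0 := ha.ne'
    field_simp
    ring
  · show ‖θ‖ ^ 2 * confClock x₀ W f U 0 ω / (‖θ‖ * Real.sqrt M) ^ 2 = 0
    rw [confClock, stopT_zero]
    simp
  · have := (hmono ω hst).1
    show ‖θ‖ ^ 2 * confClock x₀ W f U s ω / (‖θ‖ * Real.sqrt M) ^ 2 ≤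
      ‖θ‖ ^ 2 * confClock x₀ W f U t ω / (‖θ‖ * Real.sqrt M) ^ 2
    exact div_le_div_of_nonneg_right (mul_le_mul_of_nonneg_left this (sq_nonneg _)) (sq_nonneg _)
  · have h := (hmono ω hst).2
    show ‖θ‖ ^ 2 * confClock x₀ W f U t ω / (‖θ‖ * Real.sqrt M) ^ 2 -
        ‖θ‖ ^ 2 * confClock x₀ W f U s ω / (‖θ‖ * Real.sqrt M) ^ 2 ≤ (t : ℝ) - s
    rw [← sub_div, ← mul_sub, ha2, div_le_iff₀ (by positivity)]
    calc ‖θ‖ ^ 2 * (confClock x₀ W f U t ω - confClock x₀ W f U s ω) ≤ ‖θ‖ ^ 2 * (M * ((t : ℝ) - s)) :=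
          mul_le_mul_of_nonneg_left h (sq_nonneg _)
      _ = ((t : ℝ) - s) * (‖θ‖ ^ 2 * M) := by ring
  · show |(rePart θ f (confPos x₀ W U t ω) - rePart θ f x₀) / (‖θ‖ * Real.sqrt M)| ≤
      2 * B / (‖θ‖ * Real.sqrt M)
    rw [abs_div, abs_of_pos ha, div_le_div_iff_of_pos_right ha]
    have h1 := hB _ (hW.confPos_mem_closure hU hx₀ t ω)
    have h2 := hB _ (subset_closure hx₀)
    calc |rePart θ f (confPos x₀ W U t ω) - rePart θ f x₀|
        ≤ |rePart θ f (confPos x₀ W U t ω)| + |rePart θ f x₀| := abs_sub _ _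
      _ ≤ 2 * B := by linarith

end Clock

/-! ### The exponential martingale identity -/

/-- **The conformal exponential martingale.** For `f` holomorphic on the open `D`, `U` open with
compact closure in `toC⁻¹ D`, `x₀ ∈ U`, `θ ∈ ℂ`, `s ≤ t` and a bounded `𝓕_s`-measurable `G`:

  `E[G exp(i Re(θ̄ f(X_{t∧ρ})) + |θ|² σ_{t∧ρ}/2)] = E[G exp(i Re(θ̄ f(X_{s∧ρ})) + |θ|² σ_{s∧ρ}/2)]`,

`X = x₀ + W`, `ρ` the exit time of `U`, `σ` the conformal clock `∫₀ |f'(X_r)|² dr`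
([Lawler] Thm. 2.2 / [Le Gall] Thm. 7.19 in exponential-martingale form: `Re(θ̄ f(X))` is a local
martingale with bracket `|θ|² σ` for every `θ`). [cite: Lawler2005ConformallyInvariant, Thm. 2.2] -/
theorem integral_mul_cexp_conformal_eq [IsProbabilityMeasure P] (hW : IsBrownianVec W P)
    (hD : IsOpen D) (hf : DifferentiableOn ℂ f D) (hU : IsOpen U) (hUc : IsCompact (closure U))
    (hUD : closure U ⊆ toC ⁻¹' D) (hx₀ : x₀ ∈ U) (θ : ℂ) {s t : ℝ≥0} (hst : s ≤ t) {G : Ω → ℂ}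
    (hG : AEStronglyMeasurable[hW.natFiltration s] G P) (hG1 : ∀ᵐ ω ∂P, ‖G ω‖ ≤ 1) :
    ∫ ω, G ω * cexp (I * (rePart θ f (confPos x₀ W U t ω) : ℝ) +
        (‖θ‖ ^ 2 * confClock x₀ W f U t ω / 2 : ℝ)) ∂P =
      ∫ ω, G ω * cexp (I * (rePart θ f (confPos x₀ W U s ω) : ℝ) +
        (‖θ‖ ^ 2 * confClock x₀ W f U s ω / 2 : ℝ)) ∂P := by
  by_cases hθ : θ = 0
  · subst hθ
    simp [rePart]
  obtain ⟨M, hM1, hM⟩ := exists_bound_deriv_sq hD hf hUc hUD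
  obtain ⟨B, -, hB⟩ := exists_bound_rePart hD hf hUc hUD θ
  have hclock := hW.hasMartingaleClock_rePart hD hf hU hUc hUD hx₀ hθ hM1 hM hB
  have hθ' : 0 < ‖θ‖ := norm_pos_iff.2 hθ
  have hM0 : 0 < M := by linarith
  have ha : 0 < ‖θ‖ * Real.sqrt M := mul_pos hθ' (Real.sqrt_pos.2 hM0)
  -- continuity of the paths of `Y`
  have hcont : ∀ᵐ ω ∂P, Continuous fun t ↦
      (rePart θ f (confPos x₀ W U t ω) - rePart θ f x₀) / (‖θ‖ * Real.sqrt M) := by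
    refine ae_of_all _ fun ω ↦ ?_
    have hV : ContinuousOn (rePart θ f) (closure U) :=
      ((contDiffOn_rePart hD hf θ (n := 2)).continuousOn).mono hUD
    have h1 : Continuous fun t ↦ rePart θ f (confPos x₀ W U t ω) :=
      hV.comp_continuous (hW.continuous_confPos ω) fun t ↦ hW.confPos_mem_closure hU hx₀ t ω
    exact (h1.sub continuous_const).div_const _
  have key := hclock.integral_mul_cexp_eq hcont hst (‖θ‖ * Real.sqrt M) hG hG1
  -- unfold the normalisation: `a Y = V_t − V_0`, `a² clock = |θ|² σ`
  have hane : ‖θ‖ * Real.sqrt M ≠ 0 := ha.ne'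
  have e1 : ∀ r ω, ‖θ‖ * Real.sqrt M *
      ((rePart θ f (confPos x₀ W U r ω) - rePart θ f x₀) / (‖θ‖ * Real.sqrt M)) =
      rePart θ f (confPos x₀ W U r ω) - rePart θ f x₀ := fun r ω ↦ by
    field_simp
  have e2 : ∀ r ω, (‖θ‖ * Real.sqrt M) ^ 2 *
      (‖θ‖ ^ 2 * confClock x₀ W f U r ω / (‖θ‖ * Real.sqrt M) ^ 2) / 2 =
      ‖θ‖ ^ 2 * confClock x₀ W f U r ω / 2 := fun r ω ↦ by
    field_simp
  simp_rw [e1, e2] at key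
  -- multiply by the constant phase `exp(i V_0)`
  have e3 : ∀ r ω, cexp (I * (rePart θ f (confPos x₀ W U r ω) : ℝ) +
      (‖θ‖ ^ 2 * confClock x₀ W f U r ω / 2 : ℝ)) = cexp (I * (rePart θ f x₀ : ℝ)) *
        cexp (I * ((rePart θ f (confPos x₀ W U r ω) - rePart θ f x₀ : ℝ) : ℝ) +
          (‖θ‖ ^ 2 * confClock x₀ W f U r ω / 2 : ℝ)) := fun r ω ↦ by
    rw [← Complex.exp_add]
    congr 1
    push_cast
    ring
  simp_rw [e3, ← mul_assoc, mul_comm (G _) (cexp _), mul_assoc]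
  rw [integral_const_mul, integral_const_mul, key]

end IsBrownianVec

end Literature.Probability.Process

end
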